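import Mathlib.Analysis.Calculus.BumpFunction.InnerProduct
import Mathlib.Analysis.Calculus.BumpFunction.Normed
import Mathlib.Analysis.InnerProductSpace.PiL2
import Mathlib.MeasureTheory.Integral.Bochner.Basic
import Mathlib.MeasureTheory.Measure.Haar.InnerProductSpace
import Mathlib.MeasureTheory.Function.ContinuousMapDense
import Mathlib.Topology.Sequences
import Mathlib.Topology.Bases
import HarnessLib

/-!
# Crux `AdaptedKernelExists` (stmt-NavierStokesRegularity-2956), line `nash-entropy-last-block`:
  STUB `stub_kernelLimit`, part 3 — extraction of a pointwise convergent subsequence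

Helper file (lands `--supports stmt-NavierStokesRegularity-2956`) on the proof path of the
registered stub `stub_kernelLimit` (passage to the limit along a family of uniformly comparable
adapted kernels).  This file is the ABSTRACT compactness step, a real-variable lemma about a
sequence of families of nonnegative continuous slices `Gₙ(t, ·)` (`t` in an open interval
`(tₘ, T)`) of mass at most one:

* if the PAIRINGS `t ↦ ∫ ψ Gₙ(t)` with compactly supported smooth `ψ` are Lipschitz on compact
  sub-intervals uniformly in `n` (equicontinuity in time), and
* the slices `Gₙ(t, ·)` are equicontinuous at every point (uniformly in `n`),

then along a subsequence `Gₙ(t, x)` converges for EVERY `(t, x) ∈ (tₘ, T) × E`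
(`kernelLimit_extract`).  Proof: a diagonal subsequence (compactness of `∏ [−1, 1]` in the
product topology, `IsCompact.tendsto_subseq`) makes the pairings with countably many bumps
`ψ_{i,j}` (centres from a dense sequence, radii `1/(j+1)`) converge at the times of a dense
sequence; equicontinuity in time upgrades this to every `t`; spatial equicontinuity at `x` and a
bump concentrated near `x` show that `Gₙ(t, x)` is within `ε` of `∫ψGₙ(t)/∫ψ` uniformly in `n`,
hence Cauchy.  No Arzelà–Ascoli theorem and no measure theory beyond monotonicity of the
integral are used.
-/

noncomputable section

open MeasureTheory Set Filter Topology Metric Function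
open scoped ContDiff

namespace Summit.NavierStokesRegularity.NavierStokesRegularity.Theorems.AdaptedKernelExists.NashEntropyLastBlock

section General

variable {E : Type*} [NormedAddCommGroup E] [InnerProductSpace ℝ E] [FiniteDimensional ℝ E]
  [MeasurableSpace E] [BorelSpace E]

/-- A pairing of a weight `0 ≤ ψ ≤ 1` (continuous, compactly supported) with a nonnegative
continuous integrable `g` of mass at most one has absolute value at most one. -/
theorem kernelLimit_abs_integral_mul_le_one {ψ g : E → ℝ} (hψc : Continuous ψ)
    (hψs : HasCompactSupport ψ) (hψ0 : ∀ x, 0 ≤ ψ x) (hψ1 : ∀ x, ψ x ≤ 1) (hgc : Continuous g)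
    (hg0 : ∀ x, 0 ≤ g x) (hgi : Integrable g) (hg1 : ∫ x, g x ≤ 1) :
    |∫ x, ψ x * g x| ≤ 1 := by
  have hi : Integrable fun x => ψ x * g x := (hψc.mul hgc).integrable_of_hasCompactSupport hψs.mul_right
  have h0 : 0 ≤ ∫ x, ψ x * g x := integral_nonneg fun x => mul_nonneg (hψ0 x) (hg0 x)
  have h1 : ∫ x, ψ x * g x ≤ ∫ x, g x :=
    integral_mono hi hgi fun x => by
      calc ψ x * g x ≤ 1 * g x := mul_le_mul_of_nonneg_right (hψ1 x) (hg0 x)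
        _ = g x := one_mul _
  rw [abs_of_nonneg h0]
  exact h1.trans hg1

/-- If `|g(y) − g(x)| ≤ η` on the support of a nonnegative continuous compactly supported weight
`ψ`, then `|∫ ψ g − g(x) ∫ ψ| ≤ η ∫ ψ`. -/
theorem kernelLimit_abs_integral_mul_sub_le {ψ g : E → ℝ} {x : E} {η : ℝ} (hψc : Continuous ψ)
    (hψs : HasCompactSupport ψ) (hψ0 : ∀ y, 0 ≤ ψ y) (hgc : Continuous g)
    (hη : ∀ y, ψ y ≠ 0 → |g y - g x| ≤ η) :
    |(∫ y, ψ y * g y) - g x * ∫ y, ψ y| ≤ η * ∫ y, ψ y := by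
  have hi1 : Integrable fun y => ψ y * g y :=
    (hψc.mul hgc).integrable_of_hasCompactSupport hψs.mul_right
  have hi2 : Integrable fun y => ψ y * g x :=
    (hψc.mul continuous_const).integrable_of_hasCompactSupport hψs.mul_right
  have hi3 : Integrable ψ := hψc.integrable_of_hasCompactSupport hψs
  have e1 : (∫ y, ψ y * g y) - g x * ∫ y, ψ y = ∫ y, ψ y * (g y - g x) := by
    rw [mul_comm, ← integral_mul_const, ← integral_sub hi1 hi2]
    exact integral_congr_ae (Eventually.of_forall fun y => by ring)
  rw [e1]
  calc |∫ y, ψ y * (g y - g x)| ≤ ∫ y, |ψ y * (g y - g x)| := abs_integral_le_integral_abs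
    _ ≤ ∫ y, η * ψ y := by
        refine integral_mono_of_nonneg (Eventually.of_forall fun y => abs_nonneg _)
          (hi3.const_mul η) (Eventually.of_forall fun y => ?_)
        show |ψ y * (g y - g x)| ≤ η * ψ y
        by_cases hy : ψ y = 0
        · simp [hy]
        · rw [abs_mul, abs_of_nonneg (hψ0 y), mul_comm]
          exact mul_le_mul_of_nonneg_right (hη y hy) (hψ0 y)
    _ = η * ∫ y, ψ y := integral_const_mul η ψ

/-- **Extraction of a pointwise convergent subsequence.**  Let `Gₙ(t, ·)`, `t ∈ (tₘ, T)`, be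
nonnegative continuous integrable slices of mass at most one such that
(i) for every compactly supported smooth `ψ` and every compact `[t₁, t₂] ⊂ (tₘ, T)` the pairings
`t ↦ ∫ψGₙ(t)` are Lipschitz on `[t₁, t₂]` with a constant independent of `n`, and
(ii) at every `(t, x)` the slices are equicontinuous: `∀ ε>0 ∃ δ>0 ∀ n y, ‖y − x‖ ≤ δ →
|Gₙ(t,y) − Gₙ(t,x)| ≤ ε`.
Then there is a subsequence along which `Gₙ(t, x)` converges for every `t ∈ (tₘ, T)` and
every `x`. -/
theorem kernelLimit_extract {tₘ T : ℝ} {Gs : ℕ → ℝ → E → ℝ}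
    (hcont : ∀ n, ∀ t ∈ Ioo tₘ T, Continuous (Gs n t))
    (hpos : ∀ n, ∀ t ∈ Ioo tₘ T, ∀ x, 0 ≤ Gs n t x)
    (hint : ∀ n, ∀ t ∈ Ioo tₘ T, Integrable (Gs n t))
    (hmass : ∀ n, ∀ t ∈ Ioo tₘ T, ∫ x, Gs n t x ≤ 1)
    (hequi_t : ∀ ψ : E → ℝ, ContDiff ℝ ∞ ψ → HasCompactSupport ψ → ∀ t₁ t₂ : ℝ, tₘ < t₁ → t₂ < T →
      ∃ L : ℝ, ∀ n, ∀ s ∈ Icc t₁ t₂, ∀ t ∈ Icc t₁ t₂,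
        |(∫ x, ψ x * Gs n t x) - ∫ x, ψ x * Gs n s x| ≤ L * |t - s|)
    (hequi_x : ∀ t ∈ Ioo tₘ T, ∀ x : E, ∀ ε : ℝ, 0 < ε → ∃ δ : ℝ, 0 < δ ∧
      ∀ n (y : E), ‖y - x‖ ≤ δ → |Gs n t y - Gs n t x| ≤ ε) :
    ∃ φ : ℕ → ℕ, StrictMono φ ∧ ∃ Glim : ℝ → E → ℝ,
      ∀ t ∈ Ioo tₘ T, ∀ x, Tendsto (fun n => Gs (φ n) t x) atTop (𝓝 (Glim t x)) := by
  classical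
  haveI : Nonempty E := ⟨0⟩
  -- countable data: dense centres, dense times, radii `1/(j+1)`, bumps
  set c : ℕ → E := TopologicalSpace.denseSeq E with hc_def
  have hc : DenseRange c := TopologicalSpace.denseRange_denseSeq E
  set q : ℕ → ℝ := TopologicalSpace.denseSeq ℝ with hq_def
  have hq : DenseRange q := TopologicalSpace.denseRange_denseSeq ℝ
  set r : ℕ → ℝ := fun j => 1 / ((j : ℝ) + 1) with hr_def
  have hr : ∀ j, 0 < r j := fun j => by rw [hr_def]; positivity
  let ψb : ℕ → ℕ → E → ℝ := fun i j => (⟨r j, 2 * r j, hr j, by linarith [hr j]⟩ : ContDiffBump (c i))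
  have hψb_def : ∀ i j, ψb i j = (⟨r j, 2 * r j, hr j, by linarith [hr j]⟩ : ContDiffBump (c i)) :=
    fun i j => rfl
  have hψs : ∀ i j, ContDiff ℝ ∞ (ψb i j) := fun i j => ContDiffBump.contDiff _
  have hψcs : ∀ i j, HasCompactSupport (ψb i j) := fun i j => ContDiffBump.hasCompactSupport _
  have hψ0 : ∀ i j x, 0 ≤ ψb i j x := fun i j x => ContDiffBump.nonneg _
  have hψ1 : ∀ i j x, ψb i j x ≤ 1 := fun i j x => ContDiffBump.le_one _
  have hψsupp : ∀ i j x, ψb i j x ≠ 0 → ‖x - c i‖ < 2 * r j := by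
    intro i j x hx
    have : x ∈ support (ψb i j) := hx
    rw [hψb_def, ContDiffBump.support_eq] at this
    simpa [dist_eq_norm] using this
  have hψpos : ∀ i j, 0 < ∫ x, ψb i j x := fun i j => by
    rw [hψb_def]; exact ContDiffBump.integral_pos _
  -- the bounded sequence in the product space
  let Φ : ℕ → (ℕ × ℕ × ℕ → ℝ) := fun n p =>
    if q p.2.2 ∈ Ioo tₘ T then ∫ x, ψb p.1 p.2.1 x * Gs n (q p.2.2) x else 0
  have hΦdef : ∀ n p, Φ n p =
      if q p.2.2 ∈ Ioo tₘ T then ∫ x, ψb p.1 p.2.1 x * Gs n (q p.2.2) x else 0 := fun n p => rfl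
  have hΦb : ∀ n p, Φ n p ∈ Icc (-1 : ℝ) 1 := by
    intro n p
    rw [hΦdef]
    split_ifs with h
    · have := kernelLimit_abs_integral_mul_le_one (hψs p.1 p.2.1).continuous (hψcs p.1 p.2.1)
        (hψ0 p.1 p.2.1) (hψ1 p.1 p.2.1) (hcont n _ h) (hpos n _ h) (hint n _ h) (hmass n _ h)
      exact abs_le.1 this
    · exact ⟨by norm_num, by norm_num⟩
  have hK : IsCompact (Set.pi univ fun _ : ℕ × ℕ × ℕ => Icc (-1 : ℝ) 1) :=
    isCompact_univ_pi fun _ => isCompact_Icc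
  obtain ⟨a, -, φ, hφ, hlim⟩ := hK.tendsto_subseq (x := Φ) fun n => fun p _ => hΦb n p
  rw [tendsto_pi_nhds] at hlim
  refine ⟨φ, hφ, ?_⟩
  -- Claim 1: the pairings with the bumps converge at EVERY interior time
  have hpair : ∀ i j, ∀ t ∈ Ioo tₘ T,
      CauchySeq fun n => ∫ x, ψb i j x * Gs (φ n) t x := by
    intro i j t ht
    rw [Metric.cauchySeq_iff]
    intro ε hε
    -- a compact window around `t` and the uniform Lipschitz constant there
    obtain ⟨L, hL⟩ := hequi_t (ψb i j) (hψs i j) (hψcs i j) ((tₘ + t) / 2) ((t + T) / 2)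
      (by linarith [ht.1]) (by linarith [ht.2])
    set L' : ℝ := max L 1 with hL'
    have hL'0 : 0 < L' := lt_of_lt_of_le one_pos (le_max_right _ _)
    have hLL' : L ≤ L' := le_max_left _ _
    -- a time of the dense sequence very close to `t`
    set η : ℝ := min (ε / (4 * L')) (min ((t - tₘ) / 2) ((T - t) / 2)) with hη
    have hη0 : 0 < η := by
      have h1 : 0 < ε / (4 * L') := by positivity
      have h2 : 0 < (t - tₘ) / 2 := by linarith [ht.1]
      have h3 : 0 < (T - t) / 2 := by linarith [ht.2]
      exact lt_min h1 (lt_min h2 h3)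
    have hηε : η ≤ ε / (4 * L') := min_le_left _ _
    have hη1 : η ≤ (t - tₘ) / 2 := (min_le_right _ _).trans (min_le_left _ _)
    have hη2 : η ≤ (T - t) / 2 := (min_le_right _ _).trans (min_le_right _ _)
    obtain ⟨k, hk⟩ : ∃ k, q k ∈ Ioo (t - η) (t + η) :=
      hq.exists_mem_open isOpen_Ioo ⟨t, by constructor <;> linarith⟩
    have hqk : q k ∈ Ioo tₘ T := ⟨by linarith [hk.1], by linarith [hk.2]⟩
    have hqkI : q k ∈ Icc ((tₘ + t) / 2) ((t + T) / 2) := ⟨by linarith [hk.1], by linarith [hk.2]⟩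
    have htI : t ∈ Icc ((tₘ + t) / 2) ((t + T) / 2) := ⟨by linarith [ht.1], by linarith [ht.2]⟩
    have hclose : ∀ n, |(∫ x, ψb i j x * Gs (φ n) t x) - Φ (φ n) (i, j, k)| ≤ ε / 4 := by
      intro n
      rw [hΦdef, if_pos hqk]
      calc |(∫ x, ψb i j x * Gs (φ n) t x) - ∫ x, ψb i j x * Gs (φ n) (q k) x|
          ≤ L * |t - q k| := hL (φ n) (q k) hqkI t htI
        _ ≤ L' * |t - q k| := mul_le_mul_of_nonneg_right hLL' (abs_nonneg _)
        _ ≤ L' * η := by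
            refine mul_le_mul_of_nonneg_left ?_ hL'0.le
            rw [abs_le]; constructor <;> linarith [hk.1, hk.2]
        _ ≤ L' * (ε / (4 * L')) := mul_le_mul_of_nonneg_left hηε hL'0.le
        _ = ε / 4 := by field_simp
    -- the coordinate `(i, j, k)` of the convergent sequence is Cauchy
    have hcoord : CauchySeq fun n => Φ (φ n) (i, j, k) := (hlim (i, j, k)).cauchySeq
    rw [Metric.cauchySeq_iff] at hcoord
    obtain ⟨N, hN⟩ := hcoord (ε / 4) (by positivity)
    refine ⟨N, fun m hm n hn => ?_⟩
    have h1 := hclose m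
    have h2 := hclose n
    have h3 := hN m hm n hn
    rw [Real.dist_eq] at h3 ⊢
    calc |(∫ x, ψb i j x * Gs (φ m) t x) - ∫ x, ψb i j x * Gs (φ n) t x|
        ≤ |(∫ x, ψb i j x * Gs (φ m) t x) - Φ (φ m) (i, j, k)| +
            |Φ (φ m) (i, j, k) - Φ (φ n) (i, j, k)| +
            |Φ (φ n) (i, j, k) - ∫ x, ψb i j x * Gs (φ n) t x| := by
          have := abs_sub_le ((∫ x, ψb i j x * Gs (φ m) t x)) (Φ (φ m) (i, j, k))
            (∫ x, ψb i j x * Gs (φ n) t x)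
          have := abs_sub_le (Φ (φ m) (i, j, k)) (Φ (φ n) (i, j, k))
            (∫ x, ψb i j x * Gs (φ n) t x)
          linarith
      _ ≤ ε / 4 + ε / 4 + ε / 4 := by
          rw [abs_sub_comm (Φ (φ n) (i, j, k))]
          linarith
      _ < ε := by linarith
  -- Claim 2: pointwise Cauchy at every `(t, x)`
  have hpt : ∀ t ∈ Ioo tₘ T, ∀ x, CauchySeq fun n => Gs (φ n) t x := by
    intro t ht x
    rw [Metric.cauchySeq_iff]
    intro ε hε
    obtain ⟨δ, hδ, hmod⟩ := hequi_x t ht x (ε / 4) (by positivity)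
    -- a radius `r j ≤ δ/3` and a centre `c i` within `r j` of `x`
    obtain ⟨j, hj⟩ : ∃ j : ℕ, r j ≤ δ / 3 := by
      obtain ⟨j, hj⟩ := exists_nat_gt (3 / δ)
      refine ⟨j, ?_⟩
      rw [hr_def]
      dsimp only
      rw [div_le_div_iff₀ (by positivity) (by norm_num)]
      have : 3 / δ * δ = 3 := by field_simp
      nlinarith
    obtain ⟨i, hi⟩ : ∃ i, dist x (c i) < r j := hc.exists_dist_lt x (hr j)
    rw [dist_eq_norm] at hi
    -- the bump `ψ = ψb i j` is supported in `B̄(x, δ)`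
    have hsupp : ∀ y, ψb i j y ≠ 0 → ‖y - x‖ ≤ δ := by
      intro y hy
      have h1 := hψsupp i j y hy
      calc ‖y - x‖ = ‖(y - c i) + (c i - x)‖ := by rw [sub_add_sub_cancel]
        _ ≤ ‖y - c i‖ + ‖c i - x‖ := norm_add_le _ _
        _ ≤ 2 * r j + r j := by
            have : ‖c i - x‖ = ‖x - c i‖ := norm_sub_rev _ _
            linarith
        _ ≤ δ := by linarith
    set I : ℝ := ∫ y, ψb i j y with hI
    have hI0 : 0 < I := hψpos i j
    -- `Gₙ(t, x)` is within `ε/4` of `∫ψGₙ(t)/I`, uniformly in `n`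
    have hnear : ∀ n, |(∫ y, ψb i j y * Gs (φ n) t y) - Gs (φ n) t x * I| ≤ ε / 4 * I := by
      intro n
      exact kernelLimit_abs_integral_mul_sub_le (hψs i j).continuous (hψcs i j) (hψ0 i j)
        (hcont (φ n) t ht) fun y hy => hmod (φ n) y (hsupp y hy)
    have hP := hpair i j t ht
    rw [Metric.cauchySeq_iff] at hP
    obtain ⟨N, hN⟩ := hP (ε / 4 * I) (by positivity)
    refine ⟨N, fun m hm n hn => ?_⟩
    have h1 := hnear m
    have h2 := hnear n
    have h3 := hN m hm n hn
    rw [Real.dist_eq] at h3 ⊢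
    have key : |Gs (φ m) t x * I - Gs (φ n) t x * I| < ε * I := by
      calc |Gs (φ m) t x * I - Gs (φ n) t x * I|
          ≤ |Gs (φ m) t x * I - ∫ y, ψb i j y * Gs (φ m) t y| +
              |(∫ y, ψb i j y * Gs (φ m) t y) - ∫ y, ψb i j y * Gs (φ n) t y| +
              |(∫ y, ψb i j y * Gs (φ n) t y) - Gs (φ n) t x * I| := by
            have := abs_sub_le (Gs (φ m) t x * I) (∫ y, ψb i j y * Gs (φ m) t y)
              (Gs (φ n) t x * I)
            have := abs_sub_le (∫ y, ψb i j y * Gs (φ m) t y) (∫ y, ψb i j y * Gs (φ n) t y)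
              (Gs (φ n) t x * I)
            linarith
        _ ≤ ε / 4 * I + ε / 4 * I + ε / 4 * I := by
            rw [abs_sub_comm (Gs (φ m) t x * I)]
            linarith
        _ < ε * I := by nlinarith
    rw [← sub_mul, abs_mul, abs_of_pos hI0] at key
    exact lt_of_mul_lt_mul_right key hI0.le
  -- the limit
  refine ⟨fun t x => if ht : t ∈ Ioo tₘ T then (cauchySeq_tendsto_of_complete (hpt t ht x)).choose
    else 0, fun t ht x => ?_⟩
  simp only [dif_pos ht]
  exact (cauchySeq_tendsto_of_complete (hpt t ht x)).choose_spec

end General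

/-! ### Registered sub-goal (dimension three) -/

/-- **Registered sub-goal `stub_kernelLimit_extract`** (the `ℝ³` form of `kernelLimit_extract`;
part 3 of the proof of STUB `stub_kernelLimit`): extraction of a subsequence along which a
family of nonnegative continuous slices of mass at most one with equicontinuous pairings in time
and equicontinuous slices in space converges at every point. -/
theorem stub_kernelLimit_extract :
    ∀ (tₘ T : ℝ) (Gs : ℕ → ℝ → EuclideanSpace ℝ (Fin 3) → ℝ), (∀ n, ∀ t ∈ Ioo tₘ T, Continuous (Gs n t)) → (∀ n, ∀ t ∈ Ioo tₘ T, ∀ x, 0 ≤ Gs n t x) → (∀ n, ∀ t ∈ Ioo tₘ T, Integrable (Gs n t)) → (∀ n, ∀ t ∈ Ioo tₘ T, ∫ x, Gs n t x ≤ 1) → (∀ ψ : EuclideanSpace ℝ (Fin 3) → ℝ, ContDiff ℝ ∞ ψ → HasCompactSupport ψ → ∀ t₁ t₂ : ℝ, tₘ < t₁ → t₂ < T → ∃ L : ℝ, ∀ n, ∀ s ∈ Icc t₁ t₂, ∀ t ∈ Icc t₁ t₂, |(∫ x, ψ x * Gs n t x) - ∫ x, ψ x * Gs n s x| ≤ L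 * |t - s|) → (∀ t ∈ Ioo tₘ T, ∀ x : EuclideanSpace ℝ (Fin 3), ∀ ε : ℝ, 0 < ε → ∃ δ : ℝ, 0 < δ ∧ ∀ n (y : EuclideanSpace ℝ (Fin 3)), ‖y - x‖ ≤ δ → |Gs n t y - Gs n t x| ≤ ε) → ∃ φ : ℕ → ℕ, StrictMono φ ∧ ∃ Glim : ℝ → EuclideanSpace ℝ (Fin 3) → ℝ, ∀ t ∈ Ioo tₘ T, ∀ x, Tendsto (fun n => Gs (φ n) t x) atTop (𝓝 (Glim t x)) :=
  fun _ _ _ hcont hpos hint hmass hequi_t hequi_x =>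
    kernelLimit_extract hcont hpos hint hmass hequi_t hequi_x

end Summit.NavierStokesRegularity.NavierStokesRegularity.Theorems.AdaptedKernelExists.NashEntropyLastBlock

end
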